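import Mathlib.LinearAlgebra.RootSystem.Base
import Mathlib.LinearAlgebra.RootSystem.WeylGroup
import Mathlib.Analysis.SpecialFunctions.Pow.Real
import Mathlib.Analysis.Complex.Basic
import HarnessLib

/-!
# Kottwitz 1984 (Math. Ann.), §2: the Satake transform of `φ_p` (typed skeleton, with Lemma 2.3.3 concrete)

R. E. Kottwitz, *Shimura varieties and twisted orbital integrals*, Math. Ann. 269 (1984) 287–300 [Kottwitz1984TwistedOrbital],
§2 «Satake transform of `φ_p`», pp. 293–297 (open GDZ digitisation PPN235181684_0269 / LOG_0031, lit key `paper:url-15572740aaa4`;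
the statements below were read on the page IMAGES of pp. 294–297, canvas = printed page + 4; cell folder
`T/KOT/TK-t08/g0/Kottwitz1984TwistedOrbital-GDZ/`).  Quotations AS PRINTED.  Carpet file of squad TK (cell `pub/hodgecm-mathlib`,
seat TK-t08): STATEMENTS ONLY — no proof, no `sorry`, no axiom, no instance, no notation.

WHAT IS TYPED, AND HOW.
(A) CONCRETELY over Mathlib's root pairings (`RootPairing`, `RootPairing.Base`, `RootPairing.weylGroup`): the root-system **Lemma 2.3.3**
(minuscule weights: `⟨p, α^∨⟩ ∈ {−1, 0, 1}` for all roots iff `Σ(p) = W·p`), with the paper's `P(R)`, `Q(R)`, `p ≥ x` and `Σ(p)` as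
definitions (`IsWeight`, `GE`, `SigmaSet`; `Q(R)` = Mathlib `P.rootSpan ℤ`) and the lemma as the predicate `Lemma233 P b p` (a named fact
with parameters: for a finite CRYSTALLOGRAPHIC root pairing over a linearly ordered ring, a base `b` and a dominant weight `p`).  DEDUP: the
tree's `Literature/Algebra/Lie/RepresentationMinusculeOrbit.lean` proves the orbit formulation for the WEIGHT SET OF A SIMPLE MODULE
(`forall_exists_weylGroup_smul_eq_iff_forall_apply_coroot_mem`, Bourbaki VIII §7.3 Prop. 6 (i) ⟺ (iii)) and
`RepresentationMinuscule.lean` Prop. 7; the abstract root-system form typed here (saturated set `Σ(p)` of a weight `p ∈ P(R)`) is the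
part their scope caveats leave open — cited, not duplicated.
(B) As a TYPED SKELETON (style of `Literature/NumberTheory/Kottwitz1992/TotalFixedPoints.lean`) over a hypothesis structure `SatakeDatum`
of BARE CARRIERS for an unramified connected reductive group `G` over a non-archimedean local field `F` (hyperspecial `K`, Hecke algebra,
unramified parameters, `^L G`-representations, `X_*(S)`): **Lemma 2.1.2** (`Lemma212`), **Theorem 2.1.3** (`Thm213`), its reformulation via
(2.3.4) (`Thm213_satake`), and **Lemma 2.3.7** (`Lemma237`).  NOTHING IS ASSERTED (a consumer takes `(h : D.P)`).

THE PRINT.  (p. 294) «Let `F^un` denote the maximal unramified extension of `F` contained in `F̄`, and let `W_F^un` denote the Weil group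
of `F^un/F` [the infinite cyclic group generated by the Frobenius element `σ_F ∈ Gal(F^un/F)`]. Let `q` denote the cardinality of the
residue field of `F`. Let `x₀` be a hyperspecial point in the building of `G` over `F`. Let `K` denote the stabilizer of `x₀` in `G(F)`,
and let `ℋ(G(F), K)`, or simply `ℋ`, denote the corresponding Hecke algebra. For `μ : 𝔾_m → G` we write `f_μ` for the characteristic
function of the double coset of `K` in `G(F)` that correspond to the `G(F)`-conjugacy class of `μ` (by Lemma 1.1.3 this is just another
way of looking at the Cartan decomposition). […] (2.1.1) The representation `Ad ∘ μ` of `𝔾_m` on `Lie(G_F̄)` has no weights other than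
`1, 0, −1`. (2.1.2) Lemma. For any `μ : 𝔾_m → G` there exists a representation `r_μ` of `^L G`, unique up to isomorphism, satisfying the
following two properties: (a) As a `Ĝ`-representation, `r_μ` is irreducible with extreme weight `μ`. (b) Let `y` be a splitting of `Ĝ`
and assume that `y` is fixed by `Γ`. Then the subgroup `W_F` of `^L G` acts trivially on the highest weight space of `r_μ` corresponding
to `y`. […] We take the point of view that the Satake transform of a function `f ∈ ℋ` is the function `π ↦ tr π(f)` on the set of
irreducible `K`-spherical representations `π` of `G(F)` (taken up to isomorphism). For an unramified admissible homomorphism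
`φ : W_F → ^L G` we denote by `π_φ` the corresponding irreducible `K`-spherical representation of `G(F)`. Finally, we choose a maximal
torus `T` of `G` and an order of its root system so that `μ` is a dominant coweight of `T`, and we write `δ` for half the sum of the
positive roots of `T`. (2.1.3) Theorem. Suppose that `μ : 𝔾_m → G` satisfies (2.1.1). Let `f_μ` be the corresponding function in the
Hecke algebra `ℋ(G(F), K)`, and let `r_μ` be as in the previous lemma. Then for any unramified admissible homomorphism `φ : W_F → ^L G`
we have `tr π_φ(f_μ) = q^{⟨δ,μ⟩} tr(r_μ(φ(σ_F)))`.»  (p. 296) «At this point we need a result about root systems. Let `R` be a root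
system, and let `C` be a chamber of `R`. We write `P(R)` for the group of weights of `R` and `Q(R)` for the subgroup of `P(R)` generated
by `R`. We write `W` for the Weyl group of `R`. Let `p ∈ P(R)` be a dominant weight, and let `Σ(p)` be the set of elements `p' ∈ P(R)`
such that (i) `p − p' ∈ Q(R)`, (ii) `p ≥ wp'` for all `w ∈ W`. (2.3.3) Lemma. The following conditions on `p` are equivalent:
(a) `⟨p, α^∨⟩ = −1, 0, 1` for all `α ∈ R`. (b) `Σ(p) = W·p`.» ((2.3.2): «`μ ≥ wν` […] (this means that `μ − wν` is a linear combination
of simple roots with non-negative coefficients)»; proof: «by combining several of the exercises (§1, Ex. 23, 24 and §2, Ex. 5d) at the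
end of Ch. VI of [B], we obtain the lemma».)  (p. 297) «(2.3.4) `tr r_μ(σ ⋉ t) = Σ_{ν ∈ Ω(F)·μ} ν(t)`. Therefore the conclusion of
Theorem 2.1.3 is equivalent to the statement that the Satake transform of `f_μ` is the element `q^{⟨δ,μ⟩} Σ_{ν ∈ Ω(F)·μ} ν` of the algebra
`ℂ[X_*(S)]^{Ω(F)}`. […] Let `Σ_F(μ)` be the set of `ν ∈ X_*(S)` such that (2.3.5) `μ − ν ∈ im[X_*(S_sc) → X_*(S)]`, (2.3.6) `μ ≥ wν`
for all `w ∈ Ω(F)`. […] (2.3.7) Lemma. For `ν ∈ X_*(S)` let `c(ν)` denote the coefficient of `ν` in the Satake transform of `f_μ`.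
(a) If `c(ν) ≠ 0`, then `ν ∈ Σ_F(μ)`. (b) `c(μ) = q^{⟨δ,μ⟩}`.» («valid for any dominant `μ ∈ X_*(S)`»; «If `G` is semisimple and simply
connected, then a complete proof can be obtained simply by combining [Sa] and [B–T, 4.4.4]. In the general case we apply [B–T, 4.4.4] to
the adjoint group of `G` and use the homomorphism `λ : G(F) → X^*(Z(Ĝ))^Γ` constructed in §3.»)

NOT typed: §2.2 ((2.2.1)–(2.2.2): the comparison with Langlands' `f_𝔭^{(n)}` in the Shimura setting, `tr π_φ(φ_p^G) = p^{nd/2} tr r_μ(φ(σ^n))`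
with `n = [F : ℚ_p]`, `d = dim S_K`, and the factor `[E_v : ℚ_p]^{−1}`); the body of §2.3's proof ((2.3.1), (2.3.2), the identification
`Σ_F(μ) = Ω(F)·μ`).  HC_CM is proved only modulo the printed citations until rung 0 closes; this file discharges none of them.

## References
* [Kottwitz1984TwistedOrbital] R. E. Kottwitz, *Shimura varieties and twisted orbital integrals*, Math. Ann. 269 (1984) 287–300, §2:
  (2.1.1), Lemma 2.1.2, Theorem 2.1.3 p. 294; §2.2 p. 295; (2.3.1)–(2.3.2), Lemma 2.3.3 p. 296; (2.3.4)–(2.3.6), Lemma 2.3.7 p. 297.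
* N. Bourbaki, *Groupes et algèbres de Lie*, Ch. VI §1 Ex. 23, 24, §2 Ex. 5 d) (the source of Lemma 2.3.3, as cited by Kottwitz); tree:
  `Literature/Algebra/Lie/RepresentationMinuscule.lean` (Ch. VIII §7.3 Prop. 6 (iii), Prop. 7 — the module-theoretic side).
-/

namespace Literature.NumberTheory.Kottwitz1984TwistedOrbital.SatakeTransform

universe u

/-! ## (A) Lemma 2.3.3 concretely: minuscule weights of a root system -/

section RootSystem

variable {ι : Type*} {R : Type*} {M : Type*} {N : Type*} [CommRing R] [AddCommGroup M] [Module R M]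
  [AddCommGroup N] [Module R N] (P : RootPairing ι R M N) (b : P.Base)

/-- `P(R)`, «the group of weights of `R`» (p. 296): the elements of the ambient lattice∕space `M` pairing integrally with every coroot.
[cite: Kottwitz1984TwistedOrbital, §2.3 (p. 296)] -/
def IsWeight (x : M) : Prop :=
  ∀ i : ι, ∃ n : ℤ, P.toLinearMap x (P.coroot i) = n

/-- `x` is dominant for the chamber of the base `b`: `⟨x, α^∨⟩ ≥ 0` for every simple coroot `α^∨`. [cite: Kottwitz1984TwistedOrbital, §2.3 (p. 296)] -/
def IsDominant [PartialOrder R] (x : M) : Prop :=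
  ∀ i ∈ b.support, 0 ≤ P.toLinearMap x (P.coroot i)

/-- `p ≥ x` (p. 296, (2.3.2)): «`p − x` is a linear combination of simple roots with non-negative coefficients» (non-negative INTEGER
coefficients: the additive submonoid generated by the simple roots of `b`). [cite: Kottwitz1984TwistedOrbital, (2.3.2) (p. 296)] -/
def GE (p x : M) : Prop :=
  p - x ∈ AddSubmonoid.closure (P.root '' (b.support : Set ι))

/-- `Σ(p)` (p. 296): «the set of elements `p' ∈ P(R)` such that (i) `p − p' ∈ Q(R)`, (ii) `p ≥ wp'` for all `w ∈ W`», `W` the Weyl group;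
`Q(R)`, «the subgroup of `P(R)` generated by `R`», is Mathlib's `P.rootSpan ℤ` (the `ℤ`-span of the roots).
[cite: Kottwitz1984TwistedOrbital, §2.3 (p. 296)] -/
def SigmaSet (p : M) : Set M :=
  {x | IsWeight P x ∧ p - x ∈ P.rootSpan ℤ ∧ ∀ w : P.weylGroup, GE P b p (w • x)}

/-- **[Kottwitz1984TwistedOrbital, Lemma 2.3.3]** (p. 296), AS PRINTED: «Let `p ∈ P(R)` be a dominant weight […]. Lemma. The following
conditions on `p` are equivalent: (a) `⟨p, α^∨⟩ = −1, 0, 1` for all `α ∈ R`. (b) `Σ(p) = W·p`.»  TYPED for a CRYSTALLOGRAPHIC root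
pairing `P` («Let `R` be a root system»: Bourbaki Ch. VI, axiom (RS_III) `⟨β, α^∨⟩ ∈ ℤ` = Mathlib `P.IsCrystallographic`; indexing type `ι`
finite; coefficients `R` a linearly ordered commutative ring, e.g. `ℚ`, `ℝ`), a base `b` (the chamber `C`) and `p ∈ M`: if `p` is a dominant
weight, then (a) ⟺ (b).  That Mathlib root pairings need not have spanning roots is immaterial: both (a) and (b) only see the coset
`p + Q(R)`.  Consumers should instantiate it only at (crystallographic) root systems in Bourbaki's sense — in the paper, the system `R` of
relative coroots in `X_*(S_ad)` (p. 297) — not at the non-crystallographic reflection data Mathlib's `RootPairing` also admits (excluded here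
by `[P.IsCrystallographic]`).  Named fact with parameters; no proof in a carpet file.  DEDUP: the tree proves the MODULE-THEORETIC orbit formulation — for
the weight set `𝒳` of a simple module of a split semisimple Lie algebra, «`𝒳 = W.ω` ⟺ `ω(H_α) ∈ {0, 1, −1}`» (Bourbaki VIII §7.3 Prop. 6
(i) ⟺ (iii)) is `Literature.Algebra.Lie.forall_exists_weylGroup_smul_eq_iff_forall_apply_coroot_mem`
(`Literature/Algebra/Lie/RepresentationMinusculeOrbit.lean`, whose scope caveat leaves the abstract `λ ∈ P(R)` ∕ saturated-set version
untreated); what is typed HERE is that abstract root-system form, which cannot be obtained from the module-theoretic one without the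
existence theorem for highest-weight modules. [cite: Kottwitz1984TwistedOrbital, Lemma 2.3.3 (p. 296)] -/
def Lemma233 [LinearOrder R] [IsStrictOrderedRing R] [Finite ι] [P.IsCrystallographic] (p : M) : Prop :=
  IsWeight P p → IsDominant P b p →
    ((∀ i : ι, P.toLinearMap p (P.coroot i) ∈ ({-1, 0, 1} : Set R)) ↔
      SigmaSet P b p = Set.range fun w : P.weylGroup => w • p)

end RootSystem

/-! ## (B) §2.1 and Lemma 2.3.7 — typed skeleton -/

/-- **Carriers for §2** (pp. 294–297): an unramified connected reductive group `G` over a non-archimedean local field `F`, a hyperspecial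
vertex `x₀` with stabilizer `K`, the Hecke algebra `ℋ = ℋ(G(F), K)`.  Fields:
* `q` — «the cardinality of the residue field of `F`»;
* `Cochar` — the `G(F)`-conjugacy classes of cocharacters `μ : 𝔾_m → G` (= `X_*(S)/Ω(F)` by Lemma 1.1.3), `IsMinuscule μ` — condition
  (2.1.1) («`Ad ∘ μ` […] has no weights other than `1, 0, −1`»), `twoDeltaPair μ = ⟨2δ, μ⟩ ∈ ℕ` for the dominant representative (so that
  `q^{⟨δ,μ⟩} = (√q)^{⟨2δ,μ⟩}`);
* `Hecke` — `ℋ(G(F), K)`, `f μ = f_μ` (characteristic function of the `K`-double coset of `μ`);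
* `Unram` — unramified admissible homomorphisms `φ : W_F → ^L G` (up to `Ĝ`-conjugacy), `trPi φ h = tr π_φ(h)`;
* `LRep` — isomorphism classes of finite-dimensional representations of `^L G`, `IsIrredExtreme ρ μ` — (a) of Lemma 2.1.2, `WFTrivialOnHighest ρ`
  — (b) of Lemma 2.1.2 (for every `Γ`-fixed splitting), `r μ = r_μ`, `trRepFrob ρ φ = tr ρ(φ(σ_F))`;
* `XS` — `X_*(S)` for a maximal `F`-split torus `S`, `dom μ ∈ X_*(S)` the dominant representative of `μ`, `relOrbit μ = Ω(F)·μ ⊆ X_*(S)`,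
  `SigmaF μ = Σ_F(μ)` ((2.3.5)–(2.3.6)), `satakeCoeff h ν` — the coefficient `c(ν)` of `ν` in the Satake transform of `h ∈ ℋ`, an element
  of `ℂ[X_*(S)]^{Ω(F)}`.
[cite: Kottwitz1984TwistedOrbital, §2.1 (p. 294); §2.3 (p. 297)] -/
structure SatakeDatum where
  /-- cardinality of the residue field -/
  q : ℕ
  /-- conjugacy classes of cocharacters `μ` -/
  Cochar : Type u
  /-- (2.1.1) -/
  IsMinuscule : Cochar → Prop
  /-- `⟨2δ, μ⟩` -/
  twoDeltaPair : Cochar → ℕ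
  /-- the Hecke algebra -/
  Hecke : Type u
  /-- `f_μ` -/
  f : Cochar → Hecke
  /-- unramified parameters `φ` -/
  Unram : Type u
  /-- `tr π_φ(h)` -/
  trPi : Unram → Hecke → ℂ
  /-- representations of `^L G` -/
  LRep : Type u
  /-- Lemma 2.1.2 (a) -/
  IsIrredExtreme : LRep → Cochar → Prop
  /-- Lemma 2.1.2 (b) -/
  WFTrivialOnHighest : LRep → Prop
  /-- `r_μ` -/
  r : Cochar → LRep
  /-- `tr ρ(φ(σ_F))` -/
  trRepFrob : LRep → Unram → ℂ
  /-- `X_*(S)` -/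
  XS : Type u
  /-- dominant representative of `μ` in `X_*(S)` -/
  dom : Cochar → XS
  /-- `Ω(F)·μ` -/
  relOrbit : Cochar → Set XS
  /-- `Σ_F(μ)` -/
  SigmaF : Cochar → Set XS
  /-- coefficient of `ν` in the Satake transform of `h` -/
  satakeCoeff : Hecke → XS → ℂ

namespace SatakeDatum

/-- The factor `q^{⟨δ,μ⟩} = (√q)^{⟨2δ,μ⟩}` of Theorem 2.1.3 and Lemma 2.3.7 (b). [cite: Kottwitz1984TwistedOrbital, Theorem 2.1.3 (p. 294)] -/
noncomputable def qPow (D : SatakeDatum.{u}) (μ : D.Cochar) : ℂ :=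
  ((Real.sqrt D.q ^ D.twoDeltaPair μ : ℝ) : ℂ)

/-- **[Kottwitz1984TwistedOrbital, Lemma 2.1.2]** (p. 294), AS PRINTED: «For any `μ : 𝔾_m → G` there exists a representation `r_μ` of `^L G`,
unique up to isomorphism, satisfying the following two properties: (a) As a `Ĝ`-representation, `r_μ` is irreducible with extreme weight
`μ`. (b) Let `y` be a splitting of `Ĝ` and assume that `y` is fixed by `Γ`. Then the subgroup `W_F` of `^L G` acts trivially on the highest
weight space of `r_μ` corresponding to `y`.»  TYPED: `r μ` has (a) and (b), and any class with (a) and (b) is `r μ`.  Nothing is asserted.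
[cite: Kottwitz1984TwistedOrbital, Lemma 2.1.2 (p. 294)] -/
def Lemma212 (D : SatakeDatum.{u}) : Prop :=
  ∀ μ : D.Cochar, (D.IsIrredExtreme (D.r μ) μ ∧ D.WFTrivialOnHighest (D.r μ)) ∧
    ∀ ρ : D.LRep, D.IsIrredExtreme ρ μ → D.WFTrivialOnHighest ρ → ρ = D.r μ

/-- **[Kottwitz1984TwistedOrbital, Theorem 2.1.3]** (p. 294), AS PRINTED: «Suppose that `μ : 𝔾_m → G` satisfies (2.1.1). Let `f_μ` be the
corresponding function in the Hecke algebra `ℋ(G(F), K)`, and let `r_μ` be as in the previous lemma. Then for any unramified admissible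
homomorphism `φ : W_F → ^L G` we have `tr π_φ(f_μ) = q^{⟨δ,μ⟩} tr(r_μ(φ(σ_F)))`.»  Nothing is asserted.
[cite: Kottwitz1984TwistedOrbital, Theorem 2.1.3 (p. 294)] -/
def Thm213 (D : SatakeDatum.{u}) : Prop :=
  ∀ μ : D.Cochar, D.IsMinuscule μ → ∀ φ : D.Unram, D.trPi φ (D.f μ) = D.qPow μ * D.trRepFrob (D.r μ) φ

/-- **Theorem 2.1.3 reformulated through (2.3.4)** (p. 297), AS PRINTED: «Therefore the conclusion of Theorem 2.1.3 is equivalent to the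
statement that the Satake transform of `f_μ` is the element `q^{⟨δ,μ⟩} Σ_{ν ∈ Ω(F)·μ} ν` of the algebra `ℂ[X_*(S)]^{Ω(F)}`.»  TYPED: the
coefficient function of the Satake transform of `f_μ` is `q^{⟨δ,μ⟩}` on `Ω(F)·μ` and `0` elsewhere.  Nothing is asserted.
[cite: Kottwitz1984TwistedOrbital, §2.3 (2.3.4) (p. 297)] -/
def Thm213_satake (D : SatakeDatum.{u}) : Prop :=
  ∀ μ : D.Cochar, D.IsMinuscule μ → D.satakeCoeff (D.f μ) = (D.relOrbit μ).indicator fun _ => D.qPow μ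

/-- **[Kottwitz1984TwistedOrbital, Lemma 2.3.7]** (p. 297), AS PRINTED: «For `ν ∈ X_*(S)` let `c(ν)` denote the coefficient of `ν` in the
Satake transform of `f_μ`. (a) If `c(ν) ≠ 0`, then `ν ∈ Σ_F(μ)`. (b) `c(μ) = q^{⟨δ,μ⟩}`.» («valid for any dominant `μ ∈ X_*(S)`» — no
condition (2.1.1) here.)  Nothing is asserted. [cite: Kottwitz1984TwistedOrbital, Lemma 2.3.7 (p. 297)] -/
def Lemma237 (D : SatakeDatum.{u}) : Prop :=
  ∀ μ : D.Cochar,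
    (∀ ν : D.XS, D.satakeCoeff (D.f μ) ν ≠ 0 → ν ∈ D.SigmaF μ) ∧ D.satakeCoeff (D.f μ) (D.dom μ) = D.qPow μ

end SatakeDatum

end Literature.NumberTheory.Kottwitz1984TwistedOrbital.SatakeTransform
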